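import Summits.AtomisticToContinuum.BoseEinsteinCondensation.Theses.BECInfraredBound
import Summits.AtomisticToContinuum.BoseEinsteinCondensation.Theorems.BECInfraredBoundBecUvTailKineticBudget
import Summits.AtomisticToContinuum.BoseEinsteinCondensation.Theorems.BECInfraredBoundBecUvTailOccupationWindow
import Summits.AtomisticToContinuum.BoseEinsteinCondensation.Theorems.BECInfraredBoundBecUvTailLiftOneBody
import Summits.AtomisticToContinuum.BoseEinsteinCondensation.Theorems.BECInfraredBoundBecUvTailTailArithmetic
import Literature.MathematicalPhysics.QuantumManyBody.PeriodicBoseGasFourier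
import Literature.MathematicalPhysics.QuantumManyBody.PeriodicBoseGasLocalization

/-!
# Crux `BecUvTail` (stmt-AtomisticToContinuum-8823) — `Lines/face-trace.lean` (strategist ALT line)

ALTERNATIVE skeleton for the rank-3 crux `BECInfraredBound.BecUvTail` (summed ultraviolet tail of the
inner-box plane-wave occupations of Dirichlet near-minimisers `≤ θN`), registered BESIDE the lead's live
skeleton `Sketch` (namespace `…Cruxes.BecUvTail.Collar`; never touched by this file). It targets the ONE
stub of the live skeleton still open at registration time, the one-body inequality

  `stub_oneBodyTail :  ℓ³ Σ_{‖n‖∞ > K'} |ĉ_n u|² ≤ c₀ ∫_{[0,ℓ)³}|u|² + A (ℓ/K')² ∫_{[0,ℓ)³}|∇u|²`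
  (some `c₀ < 1`, `A`, all `K' ≥ M`, every `C¹` `u : ℝ³ → ℂ`),

by a DIFFERENT MECHANISM — no cut-off `χ`, no collar, no free length scale `s`:

## The line: FACE-JUMP INTEGRATION BY PARTS, natively three-dimensional

1. (stub 1) `∫_{cell} ∂ⱼψ = ℓ⁻¹ ∫_{cell} (ψ(x|xⱼ:=ℓ) − ψ(x|xⱼ:=0)) dx` for every `C¹` `ψ` — the tree's periodic
   `integral_cell_fderiv_eq_zero` with the boundary term KEPT, the face integral being written as a cell
   integral of a function constant in `xⱼ` (no codimension-one measure is introduced).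
2. (stub 2) Hence the derivative rule with jump: `ĉ_n(∂ⱼu) = (2πi nⱼ/ℓ) ĉ_n(u) + ℓ⁻¹ ĉ_{n[j↦0]}(Jⱼu)`,
   `Jⱼu(x) = u(x|xⱼ:=ℓ) − u(x|xⱼ:=0)`.
3. (stub 4) For `|nⱼ| > K'`: solve for `ĉ_n(u)`, Young, sum: the `∂ⱼu`-part is a Chebyshev tail
   `(1+t)(ℓ/2πK')² ℓ⁻³∫|∂ⱼu|²`; the jump part is FIBRED over `n[j↦0]` and costs
   `(1+t⁻¹)(4π²)⁻¹ Σ_{|m|>K'} m⁻² · Σ|ĉ(Jⱼu)|² ≤ (1+t⁻¹)/(π²K') · ℓ⁻³∫_{cell}|Jⱼu|²` (3-D Parseval for `Jⱼu`).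
4. (stub 3) The face trace `∫_{cell}|u(x|xⱼ:=c)|² ≤ (1+σ)∫|u|² + (ℓ²/σ)∫|∂ⱼu|²` (1-D `H¹ ↪ C⁰`, fibrewise AM–GM).
5. (stub 5) Union over the three axes, `σ = K'/4`, `t = 1`:
   `c₀ = (24/π²)(1/4 + 1/M) = 6.24/π² ≈ 0.63 < 1` at `M = 100`, `A = 65/(2π²)`.

Then the crux follows from the lead's four LANDED stubs BY NAME (`Theorems.BecUvTail.stub_liftOneBody`,
`stub_occupationWindow`, `stub_tailArithmetic`, `stub_kineticBudget`; p173482, p173139, p173466, p172789) and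
pure logic (`BecUvTail_of`). Disproof used: `Disproof.becUvTail_false_without_nearMin` / `_without_finiteRange`
are honoured through `stub_kineticBudget` (the only place the near-minimiser hypothesis and `E₀ < ⊤` enter);
the tightness record (`K` must grow with the budget constant `C`) is respected by `stub_tailArithmetic`
(`K = K(C)`); no stub is an instance of a landed Negative lemma (there are none: `Negative/` is empty).

Stubs are the sorried theorems `stub_*` below (self-contained signatures over tree declarations); the
composition `BecUvTail_of` / `BecUvTail_of_stubs` is sorry-free and concludes the crux BY NAME.
-/

namespace Summit.AtomisticToContinuum.BoseEinsteinCondensation.Cruxes.BecUvTail.FaceTrace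

/-- **Integration by parts on the cell with the face term** (stub 1, the analytic core of the line). For a `C¹`
function `u` on `ℝ³`, a side `ℓ > 0` and an axis `j`, `∫_{[0,ℓ)³} ∂ⱼu = ℓ⁻¹ ∫_{[0,ℓ)³} (u(x|xⱼ:=ℓ) − u(x|xⱼ:=0)) dx`:
Fubini in the `j`-th coordinate (`MeasurableEquiv.piFinSuccAbove`, exactly as in the tree's periodic
`integral_cell_fderiv_eq_zero`) and the fundamental theorem of calculus along each line
`t ↦ u(x' + t eⱼ)` give `∫_{x'} (u(x',ℓ) − u(x',0))`; the right-hand side is the same two-dimensional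
integral written as a CELL integral of a function constant in `xⱼ` (so no face measure is ever named).
The point `x|xⱼ:=c` is `x + (c − xⱼ)eⱼ`. Why plausibly true: it is the periodic lemma with the boundary term kept.
Size M (measure-theoretic plumbing; template in tree). [folklore] -/
theorem stub_cellIBP_face :
    ∀ (ℓ : ℝ), 0 < ℓ → ∀ (u : EuclideanSpace ℝ (Fin 3) → ℂ), ContDiff ℝ 1 u → ∀ (j : Fin 3), ∫ x in Literature.MathematicalPhysics.QuantumManyBody.BoseGas.cell ℓ, fderiv ℝ u x (EuclideanSpace.single j (1 : ℝ)) = (ℓ⁻¹ : ℝ) • ∫ x in Literature.MathematicalPhysics.QuantumManyBody.BoseGas.cell ℓ, (u (x + (ℓ - x j) • EuclideanSpace.single j (1 : ℝ)) - u (x + (0 - x j) • EuclideanSpace.single j (1 : ℝ))) := by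
  sorry

/-- **The derivative rule with the face jump** (stub 2). From stub 1 applied to `ψ = conj(e_n)·u`
(product rule `∂ⱼ(ē_n u) = ē_n ∂ⱼu − (2πi nⱼ/ℓ) ē_n u`, `fderiv_cellWave_apply_single`), periodicity of
`e_n` in `xⱼ` (`cellWave_periodic`: `ē_n(x|xⱼ:=ℓ) = ē_n(x|xⱼ:=0)`) and `ē_n(x|xⱼ:=0) = ē_{n[j↦0]}(x)`
(`cellWave_apply`), one gets for EVERY `C¹` `u` (no periodicity, no support condition)
`ĉ_n(∂ⱼu) = (2πi nⱼ/ℓ) ĉ_n(u) + ℓ⁻¹ ĉ_{n[j↦0]}(Jⱼu)`, `Jⱼu(x) := u(x|xⱼ:=ℓ) − u(x|xⱼ:=0)` (the face JUMP,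
a `C¹` function on `ℝ³` constant in `xⱼ`). This generalises the tree's `cellFourierCoeff_fderiv` (periodic)
and `cellFourierCoeff_fderiv_of_support` (compact support), whose boundary term vanishes. Size S–M. [folklore] -/
theorem stub_coeff_fderiv_face :
    (∀ (ℓ : ℝ), 0 < ℓ → ∀ (u : EuclideanSpace ℝ (Fin 3) → ℂ), ContDiff ℝ 1 u → ∀ (j : Fin 3), ∫ x in Literature.MathematicalPhysics.QuantumManyBody.BoseGas.cell ℓ, fderiv ℝ u x (EuclideanSpace.single j (1 : ℝ)) = (ℓ⁻¹ : ℝ) • ∫ x in Literature.MathematicalPhysics.QuantumManyBody.BoseGas.cell ℓ, (u (x + (ℓ - x j) • EuclideanSpace.single j (1 : ℝ)) - u (x + (0 - x j) • EuclideanSpace.single j (1 : ℝ)))) → ∀ (ℓ : ℝ), 0 < ℓ → ∀ (u : EuclideanSpace ℝ (Fin 3) → ℂ), ContDiff ℝ 1 u → ∀ (j : Fin 3) (n : Fin 3 → ℤ), Literature.MathematicalPhysics.QuantumManyBody.BoseGas.cellFourierCoeff ℓ (fun x => fderiv ℝ u x (EuclideanSpace.single j (1 : ℝ))) n = (2 *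 Real.pi * Complex.I * (n j : ℂ) / (ℓ : ℂ)) * Literature.MathematicalPhysics.QuantumManyBody.BoseGas.cellFourierCoeff ℓ u n + (ℓ : ℂ)⁻¹ * Literature.MathematicalPhysics.QuantumManyBody.BoseGas.cellFourierCoeff ℓ (fun x => u (x + (ℓ - x j) • EuclideanSpace.single j (1 : ℝ)) - u (x + (0 - x j) • EuclideanSpace.single j (1 : ℝ))) (Function.update n j 0) := by
  sorry

/-- **Face-trace (restriction) inequality in cell form** (stub 3). For `c ∈ [0,ℓ]`, `σ > 0` and `C¹` `u`:
`∫_{[0,ℓ)³} |u(x|xⱼ:=c)|² dx ≤ (1+σ) ∫_{[0,ℓ)³}|u|² + (ℓ²/σ) ∫_{[0,ℓ)³}|∂ⱼu|²` — i.e. `ℓ ∫_{face}|u|² ≤ …`,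
the elementary one-dimensional trace bound `ℓ|g(c)|² ≤ ‖g‖² + 2ℓ‖g‖‖g'‖ ≤ (1+σ)‖g‖² + (ℓ²/σ)‖g'‖²`
(`|g(c)|² ≤ |g(t)|² + 2∫₀^ℓ|g||g'|`, averaged over `t ∈ [0,ℓ)`, then AM–GM FIBREWISE, so no Cauchy–Schwarz
across fibres is needed) integrated over the transverse square (line slicing as in
`BoseGasHardCoreContact.lintegral_le_of_forall_line` / the landed `BECInfraredBoundBecUvTailCollarMass`).
Why plausibly true: textbook `H¹(0,ℓ) ↪ C[0,ℓ]` with explicit constants. Size M. [folklore] -/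
theorem stub_faceTrace :
    ∀ (ℓ σ c : ℝ), 0 < ℓ → 0 < σ → 0 ≤ c → c ≤ ℓ → ∀ (u : EuclideanSpace ℝ (Fin 3) → ℂ), ContDiff ℝ 1 u → ∀ (j : Fin 3), ∫⁻ x in Literature.MathematicalPhysics.QuantumManyBody.BoseGas.cell ℓ, (‖u (x + (c - x j) • EuclideanSpace.single j (1 : ℝ))‖₊ : ENNReal) ^ 2 ≤ ENNReal.ofReal (1 + σ) * (∫⁻ x in Literature.MathematicalPhysics.QuantumManyBody.BoseGas.cell ℓ, (‖u x‖₊ : ENNReal) ^ 2) + ENNReal.ofReal (ℓ ^ 2 / σ) * ∫⁻ x in Literature.MathematicalPhysics.QuantumManyBody.BoseGas.cell ℓ, (‖fderiv ℝ u x (EuclideanSpace.single j (1 : ℝ))‖₊ : ENNReal) ^ 2 := by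
  sorry

/-- **Per-axis ultraviolet tail from the jump identity** (stub 4, Fourier side). Given the identity of stub 2,
for `|nⱼ| > K' ≥ 1`: `|ĉ_n u|² ≤ (ℓ/2π nⱼ)²[(1+t)|ĉ_n ∂ⱼu|² + (1+t⁻¹)ℓ⁻²|ĉ_{n[j↦0]} Jⱼu|²]` (Young); summing over
`{n : |nⱼ| > K'}`: the first part is `≤ (1+t)(ℓ/2πK')² Σ_n|ĉ_n∂ⱼu|² = (1+t)(ℓ/2πK')² ℓ⁻³∫|∂ⱼu|²` (Parseval
`tsum_sq_cellFourierCoeff`, `∂ⱼu` continuous); the second is fibred over `n[j↦0]`: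
`Σ_{|m|>K'} m⁻² · Σ_{n': n'ⱼ=0}|ĉ_{n'}Jⱼu|² ≤ (4/K') ℓ⁻³∫|Jⱼu|²` (`Σ_{|m|>K'} m⁻² ≤ 2/⌊K'⌋ ≤ 4/K'`, sub-sum ≤
Parseval sum, `Jⱼu` continuous), whence the constant `(1+t⁻¹)/(4π²)·(4/K') = (1+t⁻¹)/(π²K')`. Lean content:
re-indexing the subtype `{n // K' < |nⱼ|}` as `{m // K' < |m|} × (Fin 2 → ℤ)` (`Equiv.piFinSuccAbove`),
`ENNReal.tsum_prod`, `tsum_comp_le_tsum_of_injective`. Why it might fail: only the constant `4/K'` (checked: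
`⌊K'⌋ ≥ K'/2` for `K' ≥ 1`). Size M. [folklore] -/
theorem stub_axisTail :
    (∀ (ℓ : ℝ), 0 < ℓ → ∀ (u : EuclideanSpace ℝ (Fin 3) → ℂ), ContDiff ℝ 1 u → ∀ (j : Fin 3) (n : Fin 3 → ℤ), Literature.MathematicalPhysics.QuantumManyBody.BoseGas.cellFourierCoeff ℓ (fun x => fderiv ℝ u x (EuclideanSpace.single j (1 : ℝ))) n = (2 * Real.pi * Complex.I * (n j : ℂ) / (ℓ : ℂ)) * Literature.MathematicalPhysics.QuantumManyBody.BoseGas.cellFourierCoeff ℓ u n + (ℓ : ℂ)⁻¹ * Literature.MathematicalPhysics.QuantumManyBody.BoseGas.cellFourierCoeff ℓ (fun x => u (x + (ℓ - x j) • EuclideanSpace.single j (1 : ℝ)) - u (x + (0 - x j) • EuclideanSpace.single j (1 : ℝ))) (Function.update n j 0)) → ∀ (ℓ t K' : ℝ), 0 < ℓ → 0 < t → 1 ≤ K' → ∀ (u : EuclideanSpace ℝ (Fin 3) → ℂ), ContDiff ℝ 1 u → ∀ (j : Fin 3), ENNReal.ofReal ℓ ^ 3 * ∑' n : {n : Fin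 3 → ℤ // K' < |(n j : ℝ)|}, (‖Literature.MathematicalPhysics.QuantumManyBody.BoseGas.cellFourierCoeff ℓ u (n : Fin 3 → ℤ)‖₊ : ENNReal) ^ 2 ≤ ENNReal.ofReal ((1 + t) * (ℓ / (2 * Real.pi * K')) ^ 2) * (∫⁻ x in Literature.MathematicalPhysics.QuantumManyBody.BoseGas.cell ℓ, (‖fderiv ℝ u x (EuclideanSpace.single j (1 : ℝ))‖₊ : ENNReal) ^ 2) + ENNReal.ofReal ((1 + t⁻¹) / (Real.pi ^ 2 * K')) * ∫⁻ x in Literature.MathematicalPhysics.QuantumManyBody.BoseGas.cell ℓ, (‖u (x + (ℓ - x j) • EuclideanSpace.single j (1 : ℝ)) - u (x + (0 - x j) • EuclideanSpace.single j (1 : ℝ))‖₊ : ENNReal) ^ 2 := by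
  sorry

/-- **Assembly of the one-body inequality** (stub 5): the per-axis tail (stub 4) and the face trace (stub 3)
give the lead's registered `stub_oneBodyTail` VERBATIM, with explicit constants: union bound
`{‖n‖∞ > K'} ⊆ ⋃ⱼ{|nⱼ| > K'}` (sup norm on `Fin 3 → ℝ`: `Pi.norm_def`/`pi_norm_lt_iff`; tsum over the subtype ≤
sum of the three axis tsums via indicators), `t = 1`, `|Jⱼu|² ≤ 2|u(x|xⱼ:=ℓ)|² + 2|u(x|xⱼ:=0)|²`, stub 3 at
`c = ℓ` and `c = 0` with `σ = K'/4`, `Σⱼ∫|∂ⱼu|² = ∫ gradSqC u` (`lintegral_finset_sum`):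
`ℓ³ Σ_{‖n‖∞>K'}|ĉ_n u|² ≤ (24/π²)(1/4 + 1/K') ∫|u|² + ((1 + 16·4)/(2π²)) (ℓ/K')² ∫|∇u|²`, so
`c₀ = 6.24/π² < 1` (needs only `π² > 6.24`), `A = 65/(2π²)`, `M = 100`. Why it might fail: it cannot
mathematically (pure bookkeeping); Lean risk = `ℝ≥0∞` arithmetic. Size M. [folklore] -/
theorem stub_oneBodyTail_of_faces :
    (∀ (ℓ t K' : ℝ), 0 < ℓ → 0 < t → 1 ≤ K' → ∀ (u : EuclideanSpace ℝ (Fin 3) → ℂ), ContDiff ℝ 1 u → ∀ (j : Fin 3), ENNReal.ofReal ℓ ^ 3 * ∑' n : {n : Fin 3 → ℤ // K' < |(n j : ℝ)|}, (‖Literature.MathematicalPhysics.QuantumManyBody.BoseGas.cellFourierCoeff ℓ u (n : Fin 3 → ℤ)‖₊ : ENNReal) ^ 2 ≤ ENNReal.ofReal ((1 + t) * (ℓ / (2 * Real.pi * K')) ^ 2) * (∫⁻ x in Literature.MathematicalPhysics.QuantumManyBody.BoseGas.cell ℓ, (‖fderiv ℝ u x (EuclideanSpace.single j (1 : ℝ))‖₊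 : ENNReal) ^ 2) + ENNReal.ofReal ((1 + t⁻¹) / (Real.pi ^ 2 * K')) * ∫⁻ x in Literature.MathematicalPhysics.QuantumManyBody.BoseGas.cell ℓ, (‖u (x + (ℓ - x j) • EuclideanSpace.single j (1 : ℝ)) - u (x + (0 - x j) • EuclideanSpace.single j (1 : ℝ))‖₊ : ENNReal) ^ 2) → (∀ (ℓ σ c : ℝ), 0 < ℓ → 0 < σ → 0 ≤ c → c ≤ ℓ → ∀ (u : EuclideanSpace ℝ (Fin 3) → ℂ), ContDiff ℝ 1 u → ∀ (j : Fin 3), ∫⁻ x in Literature.MathematicalPhysics.QuantumManyBody.BoseGas.cell ℓ, (‖u (x + (c - x j) • EuclideanSpace.single j (1 : ℝ))‖₊ : ENNReal) ^ 2 ≤ ENNReal.ofReal (1 + σ) * (∫⁻ x in Literature.MathematicalPhysics.QuantumManyBody.BoseGas.cell ℓ, (‖u x‖₊ : ENNReal) ^ 2) + ENNReal.ofReal (ℓ ^ 2 / σ) * ∫⁻ x in Literature.MathematicalPhysics.QuantumManyBody.BoseGas.cell ℓ, (‖fderiv ℝ u x (EuclideanSpace.single j (1 : ℝ))‖₊ :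 ENNReal) ^ 2) → ∃ c₀ : ℝ, 0 ≤ c₀ ∧ c₀ < 1 ∧ ∃ A : ℝ, 0 ≤ A ∧ ∃ M : ℝ, 1 ≤ M ∧ ∀ (ℓ K' : ℝ) (u : EuclideanSpace ℝ (Fin 3) → ℂ), 0 < ℓ → M ≤ K' → ContDiff ℝ 1 u → ENNReal.ofReal ℓ ^ 3 * ∑' n : {n : Fin 3 → ℤ // K' < ‖(fun j => (n j : ℝ))‖}, (‖Literature.MathematicalPhysics.QuantumManyBody.BoseGas.cellFourierCoeff ℓ u (n : Fin 3 → ℤ)‖₊ : ENNReal) ^ 2 ≤ ENNReal.ofReal c₀ * (∫⁻ x in Literature.MathematicalPhysics.QuantumManyBody.BoseGas.cell ℓ, (‖u x‖₊ : ENNReal) ^ 2) + ENNReal.ofReal (A * (ℓ / K') ^ 2) * ∫⁻ x in Literature.MathematicalPhysics.QuantumManyBody.BoseGas.cell ℓ, Literature.MathematicalPhysics.QuantumManyBody.BoseGas.gradSqC u x := by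
  sorry

/-! ### Registered-name aliases of the stub statements (device of `Lines/birth.lean`) -/
namespace __Registered

/-- The statement of `stub_cellIBP_face`, verbatim, keyed by the registered stub name. -/
abbrev stub_cellIBP_face : Prop :=
    ∀ (ℓ : ℝ), 0 < ℓ → ∀ (u : EuclideanSpace ℝ (Fin 3) → ℂ), ContDiff ℝ 1 u → ∀ (j : Fin 3), ∫ x in Literature.MathematicalPhysics.QuantumManyBody.BoseGas.cell ℓ, fderiv ℝ u x (EuclideanSpace.single j (1 : ℝ)) = (ℓ⁻¹ : ℝ) • ∫ x in Literature.MathematicalPhysics.QuantumManyBody.BoseGas.cell ℓ, (u (x + (ℓ - x j) • EuclideanSpace.single j (1 : ℝ)) - u (x + (0 - x j) • EuclideanSpace.single j (1 : ℝ)))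

/-- The statement of `stub_coeff_fderiv_face`, verbatim, keyed by the registered stub name. -/
abbrev stub_coeff_fderiv_face : Prop :=
    (∀ (ℓ : ℝ), 0 < ℓ → ∀ (u : EuclideanSpace ℝ (Fin 3) → ℂ), ContDiff ℝ 1 u → ∀ (j : Fin 3), ∫ x in Literature.MathematicalPhysics.QuantumManyBody.BoseGas.cell ℓ, fderiv ℝ u x (EuclideanSpace.single j (1 : ℝ)) = (ℓ⁻¹ : ℝ) • ∫ x in Literature.MathematicalPhysics.QuantumManyBody.BoseGas.cell ℓ, (u (x + (ℓ - x j) • EuclideanSpace.single j (1 : ℝ)) - u (x + (0 - x j) • EuclideanSpace.single j (1 : ℝ)))) → ∀ (ℓ : ℝ), 0 < ℓ → ∀ (u : EuclideanSpace ℝ (Fin 3) → ℂ), ContDiff ℝ 1 u → ∀ (j : Fin 3) (n : Fin 3 → ℤ), Literature.MathematicalPhysics.QuantumManyBody.BoseGas.cellFourierCoeff ℓ (fun x => fderiv ℝ u x (EuclideanSpace.single j (1 : ℝ))) n = (2 * Real.pi * Complex.I * (n j : ℂ) / (ℓ : ℂ)) * Literature.MathematicalPhysics.QuantumManyBody.BoseGas.cellFourierCoeff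 ℓ u n + (ℓ : ℂ)⁻¹ * Literature.MathematicalPhysics.QuantumManyBody.BoseGas.cellFourierCoeff ℓ (fun x => u (x + (ℓ - x j) • EuclideanSpace.single j (1 : ℝ)) - u (x + (0 - x j) • EuclideanSpace.single j (1 : ℝ))) (Function.update n j 0)

/-- The statement of `stub_faceTrace`, verbatim, keyed by the registered stub name. -/
abbrev stub_faceTrace : Prop :=
    ∀ (ℓ σ c : ℝ), 0 < ℓ → 0 < σ → 0 ≤ c → c ≤ ℓ → ∀ (u : EuclideanSpace ℝ (Fin 3) → ℂ), ContDiff ℝ 1 u → ∀ (j : Fin 3), ∫⁻ x in Literature.MathematicalPhysics.QuantumManyBody.BoseGas.cell ℓ, (‖u (x + (c - x j) • EuclideanSpace.single j (1 : ℝ))‖₊ : ENNReal) ^ 2 ≤ ENNReal.ofReal (1 + σ) * (∫⁻ x in Literature.MathematicalPhysics.QuantumManyBody.BoseGas.cell ℓ, (‖u x‖₊ : ENNReal) ^ 2) + ENNReal.ofReal (ℓ ^ 2 / σ) * ∫⁻ x in Literature.MathematicalPhysics.QuantumManyBody.BoseGas.cell ℓ, (‖fderiv ℝ u x (EuclideanSpace.single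 j (1 : ℝ))‖₊ : ENNReal) ^ 2

/-- The statement of `stub_axisTail`, verbatim, keyed by the registered stub name. -/
abbrev stub_axisTail : Prop :=
    (∀ (ℓ : ℝ), 0 < ℓ → ∀ (u : EuclideanSpace ℝ (Fin 3) → ℂ), ContDiff ℝ 1 u → ∀ (j : Fin 3) (n : Fin 3 → ℤ), Literature.MathematicalPhysics.QuantumManyBody.BoseGas.cellFourierCoeff ℓ (fun x => fderiv ℝ u x (EuclideanSpace.single j (1 : ℝ))) n = (2 * Real.pi * Complex.I * (n j : ℂ) / (ℓ : ℂ)) * Literature.MathematicalPhysics.QuantumManyBody.BoseGas.cellFourierCoeff ℓ u n + (ℓ : ℂ)⁻¹ * Literature.MathematicalPhysics.QuantumManyBody.BoseGas.cellFourierCoeff ℓ (fun x => u (x + (ℓ - x j) • EuclideanSpace.single j (1 : ℝ)) - u (x + (0 - x j) • EuclideanSpace.single j (1 : ℝ))) (Function.update n j 0)) → ∀ (ℓ t K' : ℝ), 0 < ℓ → 0 < t → 1 ≤ K' → ∀ (u : EuclideanSpace ℝ (Fin 3) → ℂ), ContDiff ℝ 1 u → ∀ (j : Fin 3), ENNReal.ofReal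 ℓ ^ 3 * ∑' n : {n : Fin 3 → ℤ // K' < |(n j : ℝ)|}, (‖Literature.MathematicalPhysics.QuantumManyBody.BoseGas.cellFourierCoeff ℓ u (n : Fin 3 → ℤ)‖₊ : ENNReal) ^ 2 ≤ ENNReal.ofReal ((1 + t) * (ℓ / (2 * Real.pi * K')) ^ 2) * (∫⁻ x in Literature.MathematicalPhysics.QuantumManyBody.BoseGas.cell ℓ, (‖fderiv ℝ u x (EuclideanSpace.single j (1 : ℝ))‖₊ : ENNReal) ^ 2) + ENNReal.ofReal ((1 + t⁻¹) / (Real.pi ^ 2 * K')) * ∫⁻ x in Literature.MathematicalPhysics.QuantumManyBody.BoseGas.cell ℓ, (‖u (x + (ℓ - x j) • EuclideanSpace.single j (1 : ℝ)) - u (x + (0 - x j) • EuclideanSpace.single j (1 : ℝ))‖₊ : ENNReal) ^ 2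

/-- The statement of `stub_oneBodyTail_of_faces`, verbatim, keyed by the registered stub name. -/
abbrev stub_oneBodyTail_of_faces : Prop :=
    (∀ (ℓ t K' : ℝ), 0 < ℓ → 0 < t → 1 ≤ K' → ∀ (u : EuclideanSpace ℝ (Fin 3) → ℂ), ContDiff ℝ 1 u → ∀ (j : Fin 3), ENNReal.ofReal ℓ ^ 3 * ∑' n : {n : Fin 3 → ℤ // K' < |(n j : ℝ)|}, (‖Literature.MathematicalPhysics.QuantumManyBody.BoseGas.cellFourierCoeff ℓ u (n : Fin 3 → ℤ)‖₊ : ENNReal) ^ 2 ≤ ENNReal.ofReal ((1 + t) * (ℓ / (2 * Real.pi * K')) ^ 2) * (∫⁻ x in Literature.MathematicalPhysics.QuantumManyBody.BoseGas.cell ℓ, (‖fderiv ℝ u x (EuclideanSpace.single j (1 : ℝ))‖₊ : ENNReal) ^ 2) + ENNReal.ofReal ((1 + t⁻¹) / (Real.pi ^ 2 * K')) * ∫⁻ x in Literature.MathematicalPhysics.QuantumManyBody.BoseGas.cell ℓ, (‖u (x + (ℓ - x j) • EuclideanSpace.single j (1 : ℝ)) - u (x + (0 - x j) • EuclideanSpace.single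 j (1 : ℝ))‖₊ : ENNReal) ^ 2) → (∀ (ℓ σ c : ℝ), 0 < ℓ → 0 < σ → 0 ≤ c → c ≤ ℓ → ∀ (u : EuclideanSpace ℝ (Fin 3) → ℂ), ContDiff ℝ 1 u → ∀ (j : Fin 3), ∫⁻ x in Literature.MathematicalPhysics.QuantumManyBody.BoseGas.cell ℓ, (‖u (x + (c - x j) • EuclideanSpace.single j (1 : ℝ))‖₊ : ENNReal) ^ 2 ≤ ENNReal.ofReal (1 + σ) * (∫⁻ x in Literature.MathematicalPhysics.QuantumManyBody.BoseGas.cell ℓ, (‖u x‖₊ : ENNReal) ^ 2) + ENNReal.ofReal (ℓ ^ 2 / σ) * ∫⁻ x in Literature.MathematicalPhysics.QuantumManyBody.BoseGas.cell ℓ, (‖fderiv ℝ u x (EuclideanSpace.single j (1 : ℝ))‖₊ : ENNReal) ^ 2) → ∃ c₀ : ℝ, 0 ≤ c₀ ∧ c₀ < 1 ∧ ∃ A : ℝ, 0 ≤ A ∧ ∃ M : ℝ, 1 ≤ M ∧ ∀ (ℓ K' : ℝ) (u : EuclideanSpace ℝ (Fin 3) → ℂ), 0 < ℓ → M ≤ K'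 → ContDiff ℝ 1 u → ENNReal.ofReal ℓ ^ 3 * ∑' n : {n : Fin 3 → ℤ // K' < ‖(fun j => (n j : ℝ))‖}, (‖Literature.MathematicalPhysics.QuantumManyBody.BoseGas.cellFourierCoeff ℓ u (n : Fin 3 → ℤ)‖₊ : ENNReal) ^ 2 ≤ ENNReal.ofReal c₀ * (∫⁻ x in Literature.MathematicalPhysics.QuantumManyBody.BoseGas.cell ℓ, (‖u x‖₊ : ENNReal) ^ 2) + ENNReal.ofReal (A * (ℓ / K') ^ 2) * ∫⁻ x in Literature.MathematicalPhysics.QuantumManyBody.BoseGas.cell ℓ, Literature.MathematicalPhysics.QuantumManyBody.BoseGas.gradSqC u x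

end __Registered

/-- The one-body target of the line: the statement of the lead's registered `stub_oneBodyTail`
(skeleton `Sketch`, namespace `…Cruxes.BecUvTail.Collar`), verbatim. [folklore] -/
abbrev OneBodyTail : Prop :=
    ∃ c₀ : ℝ, 0 ≤ c₀ ∧ c₀ < 1 ∧ ∃ A : ℝ, 0 ≤ A ∧ ∃ M : ℝ, 1 ≤ M ∧ ∀ (ℓ K' : ℝ) (u : EuclideanSpace ℝ (Fin 3) → ℂ), 0 < ℓ → M ≤ K' → ContDiff ℝ 1 u → ENNReal.ofReal ℓ ^ 3 * ∑' n : {n : Fin 3 → ℤ // K' < ‖(fun j => (n j : ℝ))‖}, (‖Literature.MathematicalPhysics.QuantumManyBody.BoseGas.cellFourierCoeff ℓ u (n : Fin 3 → ℤ)‖₊ : ENNReal) ^ 2 ≤ ENNReal.ofReal c₀ * (∫⁻ x in Literature.MathematicalPhysics.QuantumManyBody.BoseGas.cell ℓ, (‖u x‖₊ : ENNReal) ^ 2) + ENNReal.ofReal (A * (ℓ / K') ^ 2) * ∫⁻ x in Literature.MathematicalPhysics.QuantumManyBody.BoseGas.cell ℓ, Literature.MathematicalPhysics.QuantumManyBody.BoseGas.gradSqC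 u x

/-- The five stubs of this line prove the lead's `stub_oneBodyTail` statement (pure logic). [folklore] -/
theorem oneBodyTail_of :
    __Registered.stub_cellIBP_face → __Registered.stub_coeff_fderiv_face → __Registered.stub_faceTrace →
    __Registered.stub_axisTail → __Registered.stub_oneBodyTail_of_faces → OneBodyTail :=
  fun h1 h2 h3 h4 h5 => h5 (h4 (h2 h1)) h3

/-! ### The assembly -/

/-- THE SKELETON THEOREM, HYPOTHESIS FORM (real proof, no `sorry`): the five stub statements — under their
REGISTERED NAMES (reducible aliases `__Registered.stub_X`) — imply the crux `BECInfraredBound.BecUvTail`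
BY NAME. Chain: stubs 1–5 give the one-body inequality with constants `(c₀, A, M)`; the landed
`stub_liftOneBody` + `stub_occupationWindow` lift it to every Dirichlet trial state
(`Σ_{K'<‖k‖} ⟨w_k, γ_Ψ w_k⟩ ≤ c₀N + A(ℓ/K')²∫|∇Ψ|²`); the landed `stub_tailArithmetic` turns that, for the
budget constant `C` of the landed `stub_kineticBudget`, into `K(C), θ < 1`; finally the two `∀ᶠ N`
eventualities are intersected and the near-minimiser's kinetic budget is fed in. [folklore] -/
theorem BecUvTail_of :
    __Registered.stub_cellIBP_face → __Registered.stub_coeff_fderiv_face → __Registered.stub_faceTrace →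
    __Registered.stub_axisTail → __Registered.stub_oneBodyTail_of_faces →
    Summit.AtomisticToContinuum.BoseEinsteinCondensation.Theses.BECInfraredBound.BecUvTail := by
  intro h1 h2 h3 h4 h5 v hv
  obtain ⟨c₀, hc₀, hc₁, A, hA, M, hM, hone⟩ := oneBodyTail_of h1 h2 h3 h4 h5
  obtain ⟨C, hC, ρ₀, hρ₀, H1⟩ :=
    Summit.AtomisticToContinuum.BoseEinsteinCondensation.Theorems.BecUvTail.stub_kineticBudget v hv
  have hmany :=
    Summit.AtomisticToContinuum.BoseEinsteinCondensation.Theorems.BecUvTail.stub_liftOneBody c₀ A M hc₀ hA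
      hone Summit.AtomisticToContinuum.BoseEinsteinCondensation.Theorems.BecUvTail.stub_occupationWindow
  obtain ⟨K, hK, θ, hθ, H2⟩ :=
    Summit.AtomisticToContinuum.BoseEinsteinCondensation.Theorems.BecUvTail.stub_tailArithmetic c₀ A M hc₀
      hc₁ hA hM hmany C hC
  refine ⟨K, hK, θ, hθ, fun ε hε hε4 => ⟨ρ₀, hρ₀, fun ρ hρ hρρ₀ => ?_⟩⟩
  filter_upwards [H1 ρ hρ hρρ₀, H2 ε hε hε4 ρ hρ] with N hN1 hN2
  obtain ⟨δ, hδ, hΨ⟩ := hN1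
  exact ⟨δ, hδ, fun Ψ hE => hN2 Ψ (hΨ Ψ hE)⟩

/-- THE SKELETON THEOREM, CLOSED FORM: the crux from the five declared stubs (its only `sorry`s are the
stubs'). [folklore] -/
theorem BecUvTail_of_stubs :
    Summit.AtomisticToContinuum.BoseEinsteinCondensation.Theses.BECInfraredBound.BecUvTail :=
  BecUvTail_of stub_cellIBP_face stub_coeff_fderiv_face stub_faceTrace stub_axisTail
    stub_oneBodyTail_of_faces

end Summit.AtomisticToContinuum.BoseEinsteinCondensation.Cruxes.BecUvTail.FaceTrace
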